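import Summits.CriticalPhenomena.PercolationContinuityZ3.Theorems.SahiGridPatternOrderNThree

/-!
# The order-`n` pattern functional: strata — empty slot, nested slots (the chain theorem pointwise), full slot (Sahi's branching
# rule at pattern level: the full-slot stratum of every cell from the cell of one order less)

Support file (Sahi cell `prim-sahi`, seat `prim-sahi-typer`, generation 26; `--supports stmt-CriticalPhenomena-4575`).  Pure proofs
(two bookkeeping definitions: value relabelling `relab` and the punctured pull-back `puncture`), no `sorry`, standard axioms.

* EMPTY SLOT.  Every monomial of the kernel `K_n` uses every slot, so `K_n(M) = 0` when a row of `M` vanishes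
  (`copyKernel_eq_zero_of_row`), hence `sStarN n d A = 0` when some `A_i = ∅` (`sStarN_eq_zero_of_empty`).
* FULL SLOT = BRANCHING.  With the distinguished slot constant, the recursion collapses EXACTLY:
  `K_{n+2}(M) = n · K_{n+1}(M⁺)` when `M 0 c = 1` for all `c` (`copyKernel_of_row_zero_eq_one`) — the kernel form of Sahi's branching rule
  `E_{n+2}(1, g) = n·E_{n+1}(g)` [Sahi2008, Thm. 6].  At pattern level: decomposing each axis permutation by the image of `0`
  (`Equiv.Perm.decomposeFin`),
  `sStarN (n+2) d A = n · Σ_{v ∈ [n+2]^d} sStarN (n+1) d (puncture v ∘ A ∘ succ)`   when `A 0 = univ`   (`sStarN_head_univ_eq`),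
  where `puncture v S ⊆ [n+1]^d` is the pull-back of `S ⊆ [n+2]^d` to the sub-grid missing the value `v_a` on axis `a` (along the
  bijections `i ↦ swap 0 v_a (i+1)`; any relabelling of the values of an axis leaves `sStarN` unchanged, `sStarN_relab`, so the punctured
  sets may be re-sorted into up-sets).
* NESTED SLOTS (Blinovsky's chain theorem, POINTWISE at kernel level).  If the rows are `0/1` and absorbing in slot order
  (`M j c · M i c = M j c` for `i < j`, i.e. `A_0 ⊇ A_1 ⊇ ⋯`), every update of the recursion is trivial and
  `K_{n+2}(M) = (n + 1 − M 0 0) · K_{n+1}(M⁺)`, so `K_{n+1}(M) = ∏_{i<n} (n − i − M i i) · M n n ≥ 0` at EVERY configuration — the kernel form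
  of the chain product formula `E_{n+1} = ∏_{i<n}(n − i − E h_i)·E h_n` [LiebSahi2021, Lemma 3.2; Blinovsky2013, Lemma 1] (tree: `sahiE_chain`):
  `copyKernel_nonneg_of_absorbing`, hence **`sStarN_nonneg_of_antitone`: decreasing nested tuples are good in EVERY `(n,d)`**, with no up-set
  hypothesis and no pattern averaging.
* DIMENSION ZERO.  `K_{n+2}` of the all-ones matrix vanishes (`copyKernel_const_one_succ_succ`, Sahi's `E_n(1,…,1) = 0`), so
  `PatternPosN n 0` holds for every `n` (`patternPosN_dim_zero`).
* Consequently **`sStarN_nonneg_of_head_univ : PatternPosN (n+1) d → (A 0 = univ → up-sets → 0 ≤ sStarN (n+2) d A)`**: the full-slot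
  stratum of the cell `(d, n+2)` follows from the cell `(d, n+1)`; unconditionally (kernel) **every quadruple of up-sets of `[4]^d`, `d ≤ 3`,
  with a full first slot satisfies the order-4 pattern inequality** (`sStarN_four_nonneg_of_head_univ`, from `PatternPosN 3 d`, `d ≤ 3`).
[this work]
-/

namespace Summit.CriticalPhenomena.PercolationContinuityZ3.Theorems.SahiGridPatternN

open Finset Literature.Probability.LatticeModels
open SahiCopyKernel (copyKernel incMatrix mtail copyKernel_succ_succ copyKernel_one copyKernel_zero)
open scoped BigOperators

variable {n d : ℕ}

/-! ### Empty slot -/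

/-- `K_n(M) = 0` when some row of `M` vanishes (every monomial of the kernel uses every slot). [this work] -/
theorem copyKernel_eq_zero_of_row {R : Type*} [CommRing R] :
    ∀ (n : ℕ) (M : Fin n → Fin n → R) (i : Fin n), (∀ c, M i c = 0) → copyKernel n M = 0
  | 0, M, i, _ => copyKernel_zero M
  | 1, M, i, hi => by rw [copyKernel_one, show (0 : Fin 1) = i from Subsingleton.elim _ _, hi]
  | n + 2, M, i, hi => by
      rw [copyKernel_succ_succ]
      refine Fin.cases ?_ (fun j => ?_) i hi
      · -- the distinguished row vanishes: every updated row `i'` vanishes, and the last factor is `M 0 0 = 0`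
        intro h0
        rw [h0 0, mul_zero, sub_zero]
        refine Finset.sum_eq_zero fun i' _ => copyKernel_eq_zero_of_row (n + 1) _ i' fun c => ?_
        rw [Function.update_self, h0, mul_zero]
      · -- row `j.succ` vanishes: row `j` of `M⁺` and of every update vanishes
        intro hj
        have htail : ∀ c, mtail M j c = 0 := fun c => hj c.succ
        rw [copyKernel_eq_zero_of_row (n + 1) (mtail M) j htail, zero_mul, sub_zero]
        refine Finset.sum_eq_zero fun i' _ => copyKernel_eq_zero_of_row (n + 1) _ j fun c => ?_
        by_cases hij : j = i'
        · subst hij; rw [Function.update_self, htail, zero_mul]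
        · rw [Function.update_of_ne hij, htail]

/-- **Empty slot**: `sStarN n d A = 0` when some `A_i = ∅`. [this work] -/
theorem sStarN_eq_zero_of_empty (A : Fin n → Finset (Pn n d)) (i : Fin n) (hi : A i = ∅) : sStarN n d A = 0 := by
  unfold sStarN
  refine Finset.sum_eq_zero fun π _ => copyKernel_eq_zero_of_row n _ i fun c => ?_
  unfold incMatrix
  rw [hi]
  simp


/-! ### Nested slots: the chain theorem pointwise -/

/-- **Absorbing `0/1` matrices have a nonnegative kernel at every configuration**: if every entry is `0` or `1` and row `j` is absorbed by
row `i` whenever `i < j` (`M j c · M i c = M j c`), then `0 ≤ K_{n}(M)` — indeed `K_{n+2}(M) = (n+1−M 0 0)·K_{n+1}(M⁺)`. [this work] -/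
theorem copyKernel_nonneg_of_absorbing :
    ∀ (n : ℕ) (M : Fin n → Fin n → ℤ), (∀ i c, M i c = 0 ∨ M i c = 1) →
      (∀ i j : Fin n, i < j → ∀ c, M j c * M i c = M j c) → 0 ≤ copyKernel n M
  | 0, M, _, _ => by rw [copyKernel_zero]
  | 1, M, h01, _ => by rw [copyKernel_one]; rcases h01 0 0 with h | h <;> simp [h]
  | n + 2, M, h01, habs => by
      have hupd : ∀ i : Fin (n + 1), Function.update (mtail M) i (fun c => mtail M i c * M 0 c.succ) = mtail M := by
        intro i
        conv_rhs => rw [← Function.update_eq_self i (mtail M)]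
        congr 1
        funext c
        exact habs 0 i.succ (Fin.succ_pos i) c.succ
      have htail : 0 ≤ copyKernel (n + 1) (mtail M) :=
        copyKernel_nonneg_of_absorbing (n + 1) (mtail M) (fun i c => h01 i.succ c.succ)
          fun i j hij c => habs i.succ j.succ (Fin.succ_lt_succ_iff.2 hij) c.succ
      rw [copyKernel_succ_succ]
      simp_rw [hupd]
      rw [Finset.sum_const, Finset.card_univ, Fintype.card_fin, nsmul_eq_mul]
      have hM : M 0 0 ≤ 1 := by rcases h01 0 0 with h | h <;> simp [h]
      have key : ((n + 1 : ℕ) : ℤ) * copyKernel (n + 1) (mtail M) - copyKernel (n + 1) (mtail M) * M 0 0 =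
          copyKernel (n + 1) (mtail M) * ((n : ℤ) + 1 - M 0 0) := by push_cast; ring
      rw [key]
      exact mul_nonneg htail (by linarith)

/-- **Decreasing nested tuples are good in every `(n,d)`, pointwise**: if `A_j ⊆ A_i` for `i ≤ j` then `0 ≤ sStarN n d A` (no up-set
hypothesis; each pattern contributes a nonnegative kernel value).  In slot order this is Blinovsky's chain theorem at kernel level. [this work] -/
theorem sStarN_nonneg_of_antitone (A : Fin n → Finset (Pn n d)) (hA : ∀ i j : Fin n, i ≤ j → A j ⊆ A i) : 0 ≤ sStarN n d A := by
  unfold sStarN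
  refine Finset.sum_nonneg fun π _ => copyKernel_nonneg_of_absorbing n _ (fun i c => ?_) fun i j hij c => ?_
  · unfold incMatrix; split_ifs <;> simp
  · unfold incMatrix
    by_cases hj : col π c ∈ A j
    · have hi : col π c ∈ A i := hA i j hij.le hj
      simp [hj, hi]
    · simp [hj]

/-! ### Value relabelling -/

/-- Relabel the values of every axis by permutations `τ_a`: `relab τ S = {q : (a ↦ τ_a (q a)) ∈ S}`. [this work] -/
def relab {m : ℕ} (τ : Fin d → Equiv.Perm (Fin m)) (S : Finset (Pn m d)) : Finset (Pn m d) :=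
  univ.filter fun q => (fun a => τ a (q a)) ∈ S

/-- **`sStarN` is invariant under relabelling the values of each axis** (re-index the patterns by left multiplication).
[this work] -/
theorem sStarN_relab {m : ℕ} (τ : Fin d → Equiv.Perm (Fin m)) (B : Fin m → Finset (Pn m d)) :
    sStarN m d (fun j => relab τ (B j)) = sStarN m d B := by
  unfold sStarN
  have h : ∀ π : Fin d → Equiv.Perm (Fin m),
      incMatrix (fun j => relab τ (B j)) (col π) = incMatrix B (col fun a => τ a * π a) := by
    intro π
    funext j c
    unfold incMatrix relab col
    by_cases hp : (fun a => τ a (π a c)) ∈ B j <;> simp [hp, Equiv.Perm.mul_apply]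
  simp_rw [h]
  exact Fintype.sum_equiv (Equiv.piCongrRight fun a => Equiv.mulLeft (τ a)) _ _ fun π => rfl

/-- Sorting the values: for every family of maps `ι_a : Fin m → Fin m'` there are permutations `σ_a` with `ι_a ∘ σ_a` monotone, and
then the pull-back of an up-set along `q ↦ (a ↦ ι_a (σ_a (q a)))` is an up-set. [this work] -/
theorem isUpperSet_filter_comp_sort {m m' : ℕ} (ι : Fin d → Fin m → Fin m') {S : Finset (Pn m' d)}
    (hS : IsUpperSet (S : Set (Pn m' d))) :
    IsUpperSet ((univ.filter fun q : Pn m d => (fun a => ι a (Tuple.sort (ι a) (q a))) ∈ S : Finset (Pn m d)) :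
      Set (Pn m d)) := by
  intro q q' hqq' hq
  rw [Finset.mem_coe, mem_filter] at hq ⊢
  refine ⟨mem_univ _, hS (fun a => ?_) hq.2⟩
  exact Tuple.monotone_sort (ι a) (hqq' a)

/-! ### Full slot: the branching rule at kernel and pattern level -/

/-- **Kernel branching rule**: if the distinguished row is identically `1` then `K_{n+2}(M) = n · K_{n+1}(M⁺)` (Sahi's
`E_{n+2}(1,g) = n E_{n+1}(g)` before integration). [this work] -/
theorem copyKernel_of_row_zero_eq_one {R : Type*} [CommRing R] (M : Fin (n + 2) → Fin (n + 2) → R) (h : ∀ c, M 0 c = 1) :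
    copyKernel (n + 2) M = n * copyKernel (n + 1) (mtail M) := by
  rw [copyKernel_succ_succ]
  have hupd : ∀ i : Fin (n + 1), Function.update (mtail M) i (fun c => mtail M i c * M 0 c.succ) = mtail M := by
    intro i
    conv_rhs => rw [← Function.update_eq_self i (mtail M)]
    congr 1
    funext c
    rw [h, mul_one]
  simp_rw [hupd]
  rw [Finset.sum_const, Finset.card_univ, Fintype.card_fin, h 0, mul_one, nsmul_eq_mul]
  push_cast
  ring

/-- The punctured pull-back: `S ⊆ [n+2]^d` seen on the sub-grid `[n+2]^d` minus the value `v_a` on axis `a`, parametrised by `[n+1]^d`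
along `i ↦ swap 0 v_a (i+1)` (the parametrisation of `Equiv.Perm.decomposeFin`; not monotone — re-sort with `sStarN_relab`).
[this work] -/
def puncture (v : Pn (n + 2) d) (S : Finset (Pn (n + 2) d)) : Finset (Pn (n + 1) d) :=
  univ.filter fun q => (fun a => Equiv.swap 0 (v a) (q a).succ) ∈ S

/-- The patterns of order `n+2` ↔ (first point, patterns of order `n+1`), axis by axis. [this work] -/
def patternDecompose (n d : ℕ) :
    (Fin d → Equiv.Perm (Fin (n + 2))) ≃ (Pn (n + 2) d) × (Fin d → Equiv.Perm (Fin (n + 1))) :=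
  (Equiv.piCongrRight fun _ => Equiv.Perm.decomposeFin).trans (Equiv.arrowProdEquivProdArrow _ _ _)

/-- The inverse decomposition, pointwise. [this work] -/
theorem patternDecompose_symm_apply (v : Pn (n + 2) d) (π' : Fin d → Equiv.Perm (Fin (n + 1))) (a : Fin d) :
    (patternDecompose n d).symm (v, π') a = Equiv.Perm.decomposeFin.symm (v a, π' a) := rfl

/-- Under the decomposition, the tail of the incidence matrix of `A` at an order-`(n+2)` pattern is the incidence matrix of the
punctured family at the order-`(n+1)` pattern. [this work] -/
theorem mtail_incMatrix_decompose (A : Fin (n + 2) → Finset (Pn (n + 2) d)) (v : Pn (n + 2) d)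
    (π' : Fin d → Equiv.Perm (Fin (n + 1))) :
    mtail (incMatrix A (col ((patternDecompose n d).symm (v, π')))) =
      incMatrix (fun j => puncture v (A j.succ)) (col π') := by
  funext j c
  have hcol : col ((patternDecompose n d).symm (v, π')) c.succ = fun a => Equiv.swap 0 (v a) (π' a c).succ := by
    funext a
    show ((patternDecompose n d).symm (v, π') a) c.succ = _
    rw [patternDecompose_symm_apply, Equiv.Perm.decomposeFin_symm_apply_succ]
  unfold mtail incMatrix puncture
  rw [hcol]
  simp only [mem_filter, mem_univ, true_and]
  rfl

/-- **Branching at pattern level**: for `A 0 = univ`,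
`sStarN (n+2) d A = n · Σ_{v ∈ [n+2]^d} sStarN (n+1) d (puncture v ∘ A ∘ succ)`. [this work] -/
theorem sStarN_head_univ_eq (A : Fin (n + 2) → Finset (Pn (n + 2) d)) (hA0 : A 0 = univ) :
    sStarN (n + 2) d A = n * ∑ v : Pn (n + 2) d, sStarN (n + 1) d (fun j => puncture v (A j.succ)) := by
  unfold sStarN
  have hrow : ∀ π : Fin d → Equiv.Perm (Fin (n + 2)), ∀ c, incMatrix A (col π) 0 c = 1 := by
    intro π c; unfold incMatrix; rw [hA0]; simp
  rw [Finset.sum_congr rfl fun π _ => copyKernel_of_row_zero_eq_one _ (hrow π), ← Finset.mul_sum]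
  congr 1
  rw [← Equiv.sum_comp (patternDecompose n d).symm, Fintype.sum_prod_type]
  refine Finset.sum_congr rfl fun v _ => Finset.sum_congr rfl fun π' _ => ?_
  rw [mtail_incMatrix_decompose]

/-- **The full-slot stratum of the cell `(d, n+2)` from the cell `(d, n+1)`**: given `PatternPosN (n+1) d`, every `(n+2)`-tuple of up-sets
of `[n+2]^d` whose first set is the whole cube satisfies the order-`(n+2)` pattern inequality. [this work] -/
theorem sStarN_nonneg_of_head_univ (hP : PatternPosN (n + 1) d) (A : Fin (n + 2) → Finset (Pn (n + 2) d)) (hA0 : A 0 = univ)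
    (hA : ∀ j, IsUpperSet (A j : Set (Pn (n + 2) d))) : 0 ≤ sStarN (n + 2) d A := by
  rw [sStarN_head_univ_eq A hA0]
  refine mul_nonneg (by exact_mod_cast Nat.zero_le n) (Finset.sum_nonneg fun v _ => ?_)
  -- re-sort the punctured sets into up-sets
  let ι : Fin d → Fin (n + 1) → Fin (n + 2) := fun a i => Equiv.swap 0 (v a) i.succ
  let σ : Fin d → Equiv.Perm (Fin (n + 1)) := fun a => Tuple.sort (ι a)
  rw [← sStarN_relab σ]
  refine hP _ fun j => ?_
  have hset : relab σ (puncture v (A j.succ)) =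
      univ.filter fun q : Pn (n + 1) d => (fun a => ι a (Tuple.sort (ι a) (q a))) ∈ A j.succ := by
    ext q
    unfold relab puncture
    simp only [mem_filter, mem_univ, true_and]
    rfl
  rw [hset]
  exact isUpperSet_filter_comp_sort ι (hA j.succ)

/-- **Unconditional order-4 stratum**: for `d ≤ 3`, every quadruple of up-sets of `[4]^d` with a full first slot satisfies the order-4
pattern inequality (kernel: `PatternPosN 3 d` for `d ≤ 3` is p1's `[3]³` theorem). [this work] -/
theorem sStarN_four_nonneg_of_head_univ (hd : d ≤ 3) (A : Fin 4 → Finset (Pn 4 d)) (hA0 : A 0 = univ)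
    (hA : ∀ j, IsUpperSet (A j : Set (Pn 4 d))) : 0 ≤ sStarN 4 d A :=
  sStarN_nonneg_of_head_univ (patternPosN_three_of_le_three hd) A hA0 hA


/-! ### Dimension zero -/

/-- The all-ones matrix: `K_{n+2}(𝟙) = 0` (Sahi's `E_n(1,…,1) = 0`, `n ≥ 2`, at kernel level). [this work] -/
theorem copyKernel_const_one_succ_succ {R : Type*} [CommRing R] (n : ℕ) :
    copyKernel (n + 2) (fun _ _ : Fin (n + 2) => (1 : R)) = 0 := by
  induction n with
  | zero =>
      rw [copyKernel_of_row_zero_eq_one _ (fun _ => rfl)]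
      simp
  | succ m ih =>
      rw [copyKernel_of_row_zero_eq_one _ (fun _ => rfl)]
      show ((m + 1 : ℕ) : R) * copyKernel (m + 2) (fun _ _ : Fin (m + 2) => (1 : R)) = 0
      rw [ih, mul_zero]

/-- **`PatternPosN n 0` for every `n`**: on the one-point cube `[n]^0` every slot is `∅` or the whole cube, and the all-ones kernel is
`1` (`n = 1`) or `0` (`n ≥ 2`). [this work] -/
theorem patternPosN_dim_zero : ∀ n : ℕ, PatternPosN n 0
  | 0 => patternPosN_zero 0
  | 1 => patternPosN_one 0
  | n + 2 => by
      intro A _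
      by_cases h : ∃ i, A i = ∅
      · obtain ⟨i, hi⟩ := h
        rw [sStarN_eq_zero_of_empty A i hi]
      · have hA : ∀ i, A i = univ := by
          intro i
          have hne : (A i).Nonempty := Finset.nonempty_iff_ne_empty.2 fun he => h ⟨i, he⟩
          obtain ⟨q, hq⟩ := hne
          refine Finset.eq_univ_of_forall fun q' => ?_
          rwa [show q' = q from Subsingleton.elim _ _]
        unfold sStarN
        refine Finset.sum_nonneg fun π _ => ?_
        have hM : incMatrix A (col π) = fun _ _ => (1 : ℤ) := by
          funext i c; unfold incMatrix; rw [hA i]; simp only [Finset.mem_univ, if_true]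
        rw [hM, copyKernel_const_one_succ_succ]

end Summit.CriticalPhenomena.PercolationContinuityZ3.Theorems.SahiGridPatternN
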